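import Mathlib.Tactic.Linarith
import Mathlib.Tactic.Ring
import Mathlib.Tactic.NormNum
import Mathlib.Tactic.IntervalCases
import Mathlib.Tactic.NoncommRing
import HarnessLib

/-!
# The (0,1) cell of the ι-window, EXISTENCE side, XVII: eigen-sub-bundles of a double cover and the bound `h⁺ ≤ 5`
# on ι-invariant Abel–Prym curves — arithmetic skeleton of `H2-EXISTENCE-SIDE-17.md` §1

Family `hodge`, b2b cell `hweil`, `Summits/HodgeConjecture/HodgeConjecture/Theorems` (helper of item stmt-HodgeConjecture-2524, the
Weil-sixfold rung the H2 test serves). Companion to `WeilTypeLadderH2TwoThetaHabitat.lean` ([XVI]): it closes the referee objection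
W-P3g23-hplus-a to [XVI] PROPOSITION B (c)(β) — the input `h⁺(Z) ≤ 5` for the NODAL Abel–Prym curves of the RAMIFIED Prym presentations
of a principally polarised abelian fourfold.

Setting (report §1). `f : C̃ → C` a double cover of smooth projective curves over `ℂ`, `C` of genus `g_C`, étale (`r = 0`) or ramified in
two points (`r = 2`); `σ` the involution; `g̃ = g(C̃)` with `2g̃ − 2 = 2(2g_C − 2) + r`; `(P, Ξ)` the Prym variety, `dim P = p = g̃ − g_C`,
`ι_P^*Θ̃ ≡ 2Ξ` [Lange, *Abelian Varieties over the Complex Numbers* (2023) = corpus `book:lange1992-complex-abelian-varieties`, Thm 5.3.9,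
Prop 5.3.10, Lemma 5.3.11, Prop 5.3.12, §5.3 Exercises (11)–(17)]; `ψ : C̃ → P`, `x ↦ 𝒪(x − σx)`, the Abel–Prym map (`ψσ = −ψ`); for
`c ∈ P[2]` the curve `Z_c = c + ψ(C̃)` is `(−1)`-invariant with normalisation `ν_c = t_c ∘ ψ` and `(−1) ∘ ν_c = ν_c ∘ σ`; `L = 𝒪_P(2Ξ)` with its
normalised `(−1)`-linearisation, which acts by `q_L(x) = +1` on the fibre at every `x ∈ P[2]` because `L` is a square [ibid. Lemma 2.3.10,
Remark 2.3.11; Mumford 1966 §2], and `H⁰(P, L) = H⁰(P, L)₊` [ibid. Cor 2.3.9].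

THEOREM 1 (report): (E) for a `σ`-linearised line bundle `M̃` on `C̃` acting by `+1` at `r₊` and by `−1` at `r₋` of the ramification points,
`f_*M̃ = M₊ ⊕ M₋` with `f^*M_± ≅ M̃(−R_∓)`, so `2·deg M₊ = deg M̃ − r₋`, `2·deg M₋ = deg M̃ − r₊`, and `H⁰(C̃, M̃)^± = H⁰(C, M_±)`;
(D) `deg ν_c^*L = ((1−σ̃)^*Θ̃ · Θ̃^{g̃−1}/(g̃−1)!) = Tr_a((1−σ̃)′(1−σ̃)) = 2(g̃ − tr(σ^*|H⁰(ω_{C̃}))) = 4(g̃ − g_C) = 4p` [Poincaré ibid. Thm 4.2.2;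
ibid. Lemma 2.4.7]; (S) the induced `σ`-linearisation of `ν_c^*L` is `+1` at every ramification point (`ν_c(p̃) = c ∈ P[2]`); hence in the
ramified case with `p = g_C = 4`: `deg M₊ = 8 > 2g_C − 2`, `deg M₋ = 7 > 2g_C − 2`, `h⁰(M₊) = 5`, `h⁰(M₋) = 4`, and
`h⁺(Z_c) := dim H⁰(Z_c, L|_{Z_c})^+ ≤ dim H⁰(C̃, ν_c^*L)^+ = 5`; in the étale case `deg M_± = 8 = 2g_C − 2` (`g_C = 5`), `h⁰(M_±) ≤ 5`.
COROLLARY: [XVI] PROPOSITION B (c)(β) holds without its proviso — with `h⁺ ≤ 5` and `d′ ≥ 1` every component of the incidence has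
dimension `≥ 2` (`incidence_no_nest_of_dprime_pos`). REMARK: `h⁻(Z_c) = 4` exactly and `h⁺(Z_c) ∈ {4, 5}`, with `h⁺(Z_c) = 5` iff the descent
of `M₊` to the nodal curve `C/(f(p̃) ∼ f(q̃))` (arithmetic genus `5`, degree `8 = 2·5 − 2`) is its dualising sheaf — the `+` half of the expected
isomorphism `𝒪_{Z_c}(2Ξ) ≅ ω_{Z_c}`, which is NOT needed and NOT claimed.

Def-free, fully proved ELEMENTARY statements (the integer bookkeeping of Riemann–Hurwitz, Riemann–Roch, the trace formula, the
eigen-degree lemma, the incidence table); the geometry is in the docstrings and the report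
`run/shared/lean/b2b/hodge-weil/b2b-hweil-pv3-g24/H2-EXISTENCE-SIDE-17.md`. HONEST FRAMING: structure / census results about one cell of
the ladder's H2 test on the existence side; no case of the Hodge conjecture is proved; nothing here is a rung; no statement of
[Markman 2025] is used; nothing here depends on (LP), (8.3.3), (GP17), (GP18) or (S). 0 unconditional rungs above the floor.
-/

set_option linter.dupNamespace false

namespace Summit.HodgeConjecture.HodgeConjecture.WeilTypeLadder

section H2AbelPrymEigenbundles

/-- Riemann–Hurwitz for a double cover `f : C̃ → C` with `r` (simple) ramification points: `2g̃ − 2 = 2(2g_C − 2) + r`, i.e.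
`2g̃ = 4g_C − 2 + r`; the two Prym presentations of a ppav fourfold: `(g_C, r) = (4, 2)` gives `g̃ = 8`, `(g_C, r) = (5, 0)` gives `g̃ = 9`,
and in both cases `p = g̃ − g_C = 4`. Recorded: the arithmetic. [report §1.1] -/
theorem riemann_hurwitz_double_cover (gC gt r : ℤ) (h : 2 * gt - 2 = 2 * (2 * gC - 2) + r) :
    2 * gt = 4 * gC - 2 + r ∧ ((gC = 4 ∧ r = 2) → (gt = 8 ∧ gt - gC = 4)) ∧ ((gC = 5 ∧ r = 0) → (gt = 9 ∧ gt - gC = 4)) := by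
  refine ⟨by omega, ?_, ?_⟩
  · rintro ⟨h1, h2⟩; subst h1; subst h2; omega
  · rintro ⟨h1, h2⟩; subst h1; subst h2; omega

/-- THEOREM 1 (D), the endomorphism algebra step: the involution `σ̃` of `J(C̃)` induced by `σ` preserves the canonical polarisation, so its
Rosati involution is `σ̃′ = σ̃⁻¹ = σ̃`, and `(1 − σ̃)′(1 − σ̃) = (1 − σ̃)² = 2(1 − σ̃)`. Recorded: the identity `(1 − s)² = 2(1 − s)` for an
involution `s` in any ring. [report §1.3] -/
theorem one_sub_involution_sq {R : Type} [Ring R] (s : R) (hs : s * s = 1) :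
    (1 - s) * (1 - s) = 2 * (1 - s) := by
  have h1 : (1 - s) * (1 - s) = 1 - s - s + s * s := by noncomm_ring
  rw [h1, hs]; noncomm_ring

/-- THEOREM 1 (D), the trace: with `ρ_a(σ̃) = (σ^* on H⁰(ω_{C̃}))^∨`, `dim H⁰(ω_{C̃})^+ = g_C` (pull-backs from `C`) and `dim H⁰(ω_{C̃})^− = p = g̃ − g_C`
[Lange 2023 Prop 5.3.12], `Tr_a(2(1 − σ̃)) = 2(g̃ − (g_C − (g̃ − g_C))) = 4(g̃ − g_C) = 4p`; by Poincaré's formula and [Lange 2023 Lemma 2.4.7]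
this is `deg ψ^*(ι_P^*Θ̃) = deg ν_c^*𝒪_P(2Ξ)`. Both presentations of a ppav fourfold give degree `16` (and `Ξ·[Z_c] = 8`, twice the minimal
class). Recorded: the arithmetic. [report §1.3] -/
theorem abel_prym_degree (gC gt hp hm deg : ℤ) (hhp : hp = gC) (hhm : hm = gt - gC) (hdeg : deg = 2 * (gt - (hp - hm))) :
    deg = 4 * (gt - gC) ∧ ((gC = 4 ∧ gt = 8) → deg = 16) ∧ ((gC = 5 ∧ gt = 9) → deg = 16) := by
  subst hhp; subst hhm; subst hdeg
  refine ⟨by ring, ?_, ?_⟩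
  · rintro ⟨h1, h2⟩; subst h1; subst h2; norm_num
  · rintro ⟨h1, h2⟩; subst h1; subst h2; norm_num

/-- [Lange 2023 Lemma 2.4.7] for a PRINCIPAL polarisation `Θ̃` (`χ = 1`) on a `g̃`-dimensional abelian variety: `P^a_{f′f}(n) = χ(nΘ̃ − f^*Θ̃) =
((nΘ̃ − f^*Θ̃)^{g̃})/g̃!`; comparing the coefficients of `n^{g̃−1}`: `−Tr_a(f′f) = −g̃·(f^*Θ̃·Θ̃^{g̃−1})/g̃!`, i.e.
`(f^*Θ̃ · Θ̃^{g̃−1}) = (g̃−1)!·Tr_a(f′f)`. Recorded: the coefficient bookkeeping `g̃·x = g̃!·T ↔ x = (g̃−1)!·T` for `g̃! = g̃·(g̃−1)!`, `g̃ ≠ 0`.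
[report §1.3] -/
theorem trace_coefficient_bookkeeping (gt fac facpred x T : ℤ) (hg : gt ≠ 0) (hfac : fac = gt * facpred) :
    gt * x = fac * T ↔ x = facpred * T := by
  subst hfac
  constructor
  · intro h
    have : gt * x = gt * (facpred * T) := by rw [h]; ring
    exact mul_left_cancel₀ hg this
  · intro h; subst h; ring

/-- THEOREM 1 (E), the eigen-degree lemma: for a `σ`-linearised line bundle `M̃` of degree `d` on `C̃` acting by `+1` at `r₊` and by `−1` at `r₋` of
the `r = r₊ + r₋` ramification points, `f_*M̃ = M₊ ⊕ M₋` with `f^*M₊ ≅ M̃(−R₋)`, `f^*M₋ ≅ M̃(−R₊)` (local form at a ramification point: generator `e`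
with `σe = εe`, `(f_*M̃)_b = 𝒪_b·e ⊕ 𝒪_b·te`, `σ` acting by `ε`, `−ε`), hence `2 deg M₊ = d − r₋`, `2 deg M₋ = d − r₊`, and the consistency
`deg M₊ + deg M₋ = d − r/2 = deg f_*M̃` (Grothendieck–Riemann–Roch + Riemann–Hurwitz). Recorded: the degree bookkeeping. [report §1.2] -/
theorem eigen_degree_split (d rp rm dp dm : ℤ) (hp : 2 * dp = d - rm) (hm : 2 * dm = d - rp) :
    2 * (dp + dm) = 2 * d - (rp + rm) := by
  omega

/-- THEOREM 1 (E), consistency with Grothendieck–Riemann–Roch for the finite flat `f`: `χ(C, f_*M̃) = χ(C̃, M̃)`, i.e.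
`deg f_*M̃ + 2(1 − g_C) = d + 1 − g̃`, and Riemann–Hurwitz `2g̃ − 2 = 2(2g_C − 2) + r` give `2·deg f_*M̃ = 2d − r`. Recorded: the arithmetic.
[report §1.2] -/
theorem pushforward_degree (d gC gt r D : ℤ) (hRH : 2 * gt - 2 = 2 * (2 * gC - 2) + r) (hchi : D + 2 * (1 - gC) = d + 1 - gt) :
    2 * D = 2 * d - r := by
  omega

/-- THEOREM 1 (S) + (E) in the RAMIFIED presentation: `d = deg ν_c^*𝒪_P(2Ξ) = 16`, both ramification points map to `c ∈ P[2]` where the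
normalised linearisation of the square `𝒪_P(2Ξ)` acts by `q = +1` (`r₊ = 2`, `r₋ = 0`); hence `deg M₊ = 8`, `deg M₋ = 7`. Recorded: the arithmetic,
including `q² = 1 ⇒` the sign of a square is `+1`. [report §1.4] -/
theorem ramified_eigen_degrees (q dp dm : ℤ) (hq : q = 1 ∨ q = -1) (hp : 2 * dp = 16 - 0) (hm : 2 * dm = 16 - 2) :
    q ^ 2 = 1 ∧ dp = 8 ∧ dm = 7 := by
  refine ⟨?_, by omega, by omega⟩
  rcases hq with h | h <;> subst h <;> norm_num

/-- Riemann–Roch on a smooth curve of genus `g`: `h⁰ − h¹ = deg − g + 1`, and `h¹ = 0` when `deg > 2g − 2`. On `C` of genus `4`: `deg M₊ = 8 ⇒ h⁰(M₊) = 5`,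
`deg M₋ = 7 ⇒ h⁰(M₋) = 4`; on `C̃` of genus `8`: `deg 16 ⇒ h⁰ = 9 = 5 + 4`. Recorded: the arithmetic. [report §1.4] -/
theorem riemann_roch_nonspecial (deg g h0 h1 : ℤ) (rr : h0 - h1 = deg - g + 1) (hns : h1 = 0) :
    h0 = deg - g + 1 ∧ ((deg = 8 ∧ g = 4) → h0 = 5) ∧ ((deg = 7 ∧ g = 4) → h0 = 4) ∧ ((deg = 16 ∧ g = 8) → h0 = 9) := by
  subst hns
  refine ⟨by omega, ?_, ?_, ?_⟩ <;> rintro ⟨h1, h2⟩ <;> subst h1 <;> subst h2 <;> omega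

/-- THEOREM 1, conclusion (ramified presentations of a ppav fourfold): `dim H⁰(C̃, ν_c^*𝒪(2Ξ))^+ = h⁰(C, M₊) = 5`, `dim H⁰(…)^− = h⁰(C, M₋) = 4`,
`5 + 4 = 9 = h⁰(C̃, ν_c^*𝒪(2Ξ))`, and `h⁺(Z_c) = dim H⁰(Z_c, 𝒪_{Z_c}(2Ξ))^+ ≤ 5` because `H⁰(Z_c, ·) ↪ H⁰(C̃, ν_c^* ·)` equivariantly (`ν_c` finite
birational, `Z_c` reduced). This is the input of [XVI] PROPOSITION B (c)(β) (W-P3g23-hplus-a). Recorded: the assembled numbers. [report §1.4] -/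
theorem hplus_le_five_ramified (hp hm hZ : ℤ) (ehp : hp = 8 - 4 + 1) (ehm : hm = 7 - 4 + 1) (hsub : hZ ≤ hp) :
    hp = 5 ∧ hm = 4 ∧ hp + hm = 16 - 8 + 1 ∧ hZ ≤ 5 := by
  subst ehp; subst ehm; omega

/-- THEOREM 1 in the ÉTALE presentation (`g_C = 5`, `r = 0`, `d = 16`): `deg M₊ = deg M₋ = 8 = 2g_C − 2`, and a line bundle of degree `2g − 2` on a
curve of genus `g` has `h⁰ = g − 1 + h¹ ≤ g` (`h¹ = h⁰(ω ⊗ M⁻¹) ≤ 1`, degree `0`), with equality iff it is `ω_C`: so `h^±(Z) ≤ 5` for the smooth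
Abel–Prym curves too — a second proof of [XVI] 3.3 (c)(α)'s input, independent of [XVI] LEMMA 8.1. Recorded: the arithmetic. [report §1.5] -/
theorem hpm_le_five_etale (dp dm g h0 h1 : ℤ) (hp : 2 * dp = 16 - 0) (hm : 2 * dm = 16 - 0) (hg : g = 5)
    (rr : h0 - h1 = dp - g + 1) (h1le : h1 ≤ 1) :
    dp = 2 * g - 2 ∧ dm = dp ∧ h0 ≤ g ∧ h0 ≤ 5 := by
  subst hg; omega

/-- REMARK (the node): in the ramified case the anti-invariant sections vanish at both ramification points (`f^*M₋ ≅ M̃(−p̃ − q̃)`), so they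
satisfy the gluing condition of the node automatically and `h⁻(Z_c) = 4` exactly; the invariant sections `f^*t`, `t ∈ H⁰(C, M₊)`, descend to `Z_c`
iff `t` satisfies ONE linear gluing condition at `f(p̃), f(q̃)`, i.e. `H⁰(Z_c, ·)^+ = H⁰(C₀, M₀)` for the descent `M₀` of `M₊` to the nodal curve
`C₀ = C/(f(p̃) ∼ f(q̃))` of arithmetic genus `5`, `deg M₀ = 8 = 2·5 − 2`: Riemann–Roch on the integral Gorenstein curve `C₀` gives
`h⁰(M₀) = 4 + h⁰(ω_{C₀} ⊗ M₀⁻¹) ∈ {4, 5}`, `= 5` iff `M₀ ≅ ω_{C₀}`. So `h⁺(Z_c) ∈ {4, 5}` and `h⁰(Z_c, 𝒪(2Ξ)) ∈ {8, 9}`; the referee's expected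
`𝒪_{Z_c}(2Ξ) ≅ ω_{Z_c}` is equivalent on the invariant side to `h⁺(Z_c) = 5` and is NOT needed. Recorded: the arithmetic. [report §1.6] -/
theorem node_descent_h0 (pa deg h0 h1 : ℤ) (hpa : pa = 5) (hdeg : deg = 8) (rr : h0 - h1 = deg - pa + 1)
    (h1nn : 0 ≤ h1) (h1le : h1 ≤ 1) :
    deg = 2 * pa - 2 ∧ (h0 = 4 ∨ h0 = 5) ∧ (h0 = 5 ↔ h1 = 1) ∧ (h0 + 4 = 8 ∨ h0 + 4 = 9) := by
  subst hpa; subst hdeg; omega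

/-- [Lange 2023 Cor 2.3.9] for `L = 𝒪_P(2Ξ)` of type `(2,2,2,2)` and characteristic `0` (`s = 0`, `g = 4`): `h⁰(L)₊ = ½h⁰(L) + 2^{g−1} = 8 + 8 = 16 =
h⁰(L)`, `h⁰(L)₋ = 0` — every second-order theta function is even, so the restriction of `H⁰(P, 𝒪(2Ξ)) ⊃ Λ_a` to an `(−1)`-invariant curve lands in
the `+` eigenspace. Recorded: the arithmetic. [report §1.1] -/
theorem second_order_thetas_even : (2 : ℤ) ^ 4 = 16 ∧ (16 : ℤ) / 2 + 2 ^ (4 - 1) = 16 ∧ (16 : ℤ) / 2 - 2 ^ (4 - 1) = 0 := by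
  norm_num

/-- COROLLARY ([XVI] PROPOSITION B (c)(β) without proviso): in [XVI] 3.2's incidence a component over a rank-`ρ` stratum (`0 ≤ ρ ≤ 4`; `ρ = 5` has
empty fibre) of an `h⁺`-stratum of dimension `d′` has dimension `≥ max(0, 4 + d′ − (5 − ρ)(h⁺ − ρ)) + (4 − ρ)`; with `h⁺ ≤ 5` (THEOREM 1) and
`d′ ≥ 1` (the ramified presentations form a 1-dimensional family on a general fourfold, [FNS21]) this is `≥ 2` for every `ρ`: NO component of
dimension `≤ 1`, the family mechanism applies, the nodal Abel–Prym one-curve-junk row over `𝒞°` is DEAD. (With `d′ = 0` the bound allows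
exactly the pencil nests `(h⁺, ρ) = (5, 3)` of [XVI] 3.2 — `incidence_dimension_table` there.) Recorded: the inequality. [report §1.7] -/
theorem incidence_no_nest_of_dprime_pos (h d ρ : ℤ) (hh : h ≤ 5) (hd : 1 ≤ d) (hρ0 : 0 ≤ ρ) (hρ4 : ρ ≤ 4) :
    2 ≤ max (4 + d - (5 - ρ) * (h - ρ)) 0 + (4 - ρ) := by
  have hρ : ρ = 0 ∨ ρ = 1 ∨ ρ = 2 ∨ ρ = 3 ∨ ρ = 4 := by omega
  rcases hρ with e | e | e | e | e <;> subst e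
  · have := le_max_right (4 + d - (5 - (0:ℤ)) * (h - 0)) 0; omega
  · have := le_max_right (4 + d - (5 - (1:ℤ)) * (h - 1)) 0; omega
  · have := le_max_right (4 + d - (5 - (2:ℤ)) * (h - 2)) 0; omega
  · have := le_max_left (4 + d - (5 - (3:ℤ)) * (h - 3)) 0; nlinarith
  · have := le_max_left (4 + d - (5 - (4:ℤ)) * (h - 4)) 0; nlinarith

/-- COROLLARY, the jump members: along the 1-dimensional family of nodal Abel–Prym curves `h⁺ ∈ {4, 5}` (REMARK), so an `h⁺`-jump isolates at most
finitely many members (`d′ = 0` there); if the generic value is `5` the isolated members have `h⁺ = 4` and the table still gives dimension `≥ 2`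
(`h⁺ = 4`, `d′ = 0`: `ρ = 4: 4`, `ρ = 3: 3`, `ρ = 2: 2`, `ρ ≤ 1: ≥ 3`); if the generic value is `4` the isolated members have `h⁺ = 5` and are exactly
the pencil-nest residual `(5, 0, 3)` already named in [XVI] 3.3 (b). Recorded: the `h⁺ = 4`, `d′ = 0` rows. [report §1.7] -/
theorem incidence_hplus_four_isolated (ρ : ℤ) (hρ0 : 0 ≤ ρ) (hρ4 : ρ ≤ 4) :
    2 ≤ max (4 + 0 - (5 - ρ) * (4 - ρ)) 0 + (4 - ρ) := by
  have hρ : ρ = 0 ∨ ρ = 1 ∨ ρ = 2 ∨ ρ = 3 ∨ ρ = 4 := by omega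
  rcases hρ with e | e | e | e | e <;> subst e
  · have := le_max_right (4 + 0 - (5 - (0:ℤ)) * (4 - 0)) 0; omega
  · have := le_max_right (4 + 0 - (5 - (1:ℤ)) * (4 - 1)) 0; omega
  · have := le_max_left (4 + 0 - (5 - (2:ℤ)) * (4 - 2)) 0; norm_num at this ⊢
  · have := le_max_left (4 + 0 - (5 - (3:ℤ)) * (4 - 3)) 0; norm_num at this ⊢
  · have := le_max_left (4 + 0 - (5 - (4:ℤ)) * (4 - 4)) 0; norm_num at this ⊢

end H2AbelPrymEigenbundles

section H2AbelPrymEigenbundlesThetaDuals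

/-!
## ADDENDUM (report §2): the theta-duals of the Abel–Prym curves are Prym–Brill–Noether curves — integer shadows

Report `H2-EXISTENCE-SIDE-17.md` §2. For an ι-invariant Abel–Prym curve `Z ⊂ A` (ppav fourfold) the theta-dual `V_Z = {a : Z ⊂ Θ_a} = {a : Z ⊂ S_a}` is:
étale case — a translate of `V² = {E ∈ P⁻ : h⁰(E) ≥ 3}`, of dimension `dim P − 3 = 1` for every presentation with `C` non-hyperelliptic
[Casalaina-Martin–Lahoz–Viviani 2008, Lemma 2.1, Thm 2.2]; ramified case — LEMMA 2.2 (for `NS(P) = ℤξ`): in the torsor `P̃₂ = Nm⁻¹(ω_C(x+y)) ⊂ Pic^{2g}(C̃)`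
the theta divisor is `D₂ = {h⁰ ≥ 2}` with `m^*Θ̃ = 2·D₂` (`m : L ↦ L(−x̃)`), and LEMMA 2.3: `V_Z ≅ D₃ = {h⁰ ≥ 3} = V²(f, x+y) ≅ V¹(f)`, of dimension
`g − 3 = 1` for `f` generic in `ℛ_{4,2}` [Bud 2026, Thm 4.2]. PROPOSITION 2.4: `rank(H⁰(A, 2Θ) → H⁰(Z, 2Θ|_Z)) = 5` for étale `Z`. COROLLARY 2.5: dimension bounds
for `N_AP(A)`, `M_AP` and their ramified analogues; 2.6: the Mayer–Vietoris bound for `Λ_a ∩ Λ_{a′}`. Arithmetic only.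
-/

/-- [CLV08 Thm 2.2] / [DCP95]: the Prym–Brill–Noether locus `V^r ⊂ P^±` of an étale double cover (`dim P = p`) has expected (and, for `r = 2` and `C`
non-hyperelliptic, actual) dimension `p − r(r+1)/2`; for `p = 4`, `r = 2`: `1` — the theta-dual of an étale Abel–Prym curve on a ppav fourfold is a CURVE. [report 2.1] -/
theorem pbn_dim_etale (p r d : ℤ) (hd : d = p - r * (r + 1) / 2) (hp : p = 4) (hr : r = 2) : d = 1 := by
  subst hp; subst hr; subst hd; norm_num

/-- [Bud26 Thm 4.2]: for `f` generic in `ℛ_{g,2}`, `V^r(f) ≅ V^{r+1}(f, x+y)` has dimension `g − (r+1)(r+2)/2` (empty iff negative). For `g = 4`: `r = 0` gives `3 = p − 1`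
(the divisor `D₂`, LEMMA 2.2), `r = 1` gives `1` (the theta-dual `D₃`, LEMMA 2.3 — a CURVE), `r = 2` gives `−2 < 0` (`{h⁰ ≥ 4} = ∅`, so `D₃ = V²(f, x+y)` exactly). [report 2.3] -/
theorem pbn_dim_ramified (g : ℤ) (hg : g = 4) :
    g - (0 + 1) * (0 + 2) / 2 = 3 ∧ g - (1 + 1) * (1 + 2) / 2 = 1 ∧ g - (2 + 1) * (2 + 2) / 2 < 0 := by
  subst hg; norm_num

/-- LEMMA 2.2, the torsor's degrees: `C` of genus `g` with two branch points, `g̃ = 2g`; `deg ω_C(x+y) = 2g − 2 + 2 = 2g = g̃` (every `L ∈ P̃₂` is effective: Riemann–Roch gives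
`h⁰(L) − h¹(L) = 2g − 2g + 1 = 1`); `m(L) = L(−x̃)` has degree `2g − 1 = g̃ − 1` (the theta degree); `D₀ ∈ |L(−x̃−ỹ)|` has degree `2g − 2` with `Nm D₀ ∈ |ω_C|`. Recorded: the
degree bookkeeping. [report 2.2] -/
theorem ramified_torsor_degrees (g gt : ℤ) (hgt : gt = 2 * g) :
    (2 * g - 2 + 2 = gt) ∧ (gt - gt + 1 = 1) ∧ (2 * g - 1 = gt - 1) ∧ (2 * g - 2 = (2 * g - 2 + 2) - 1 - 1) := by
  subst hgt; omega

/-- LEMMA 2.2 (c), the Picard-number-one bookkeeping: `m^*Θ̃ ≡ 2ξ` and `m^*Θ̃ = Σ mᵢ·kᵢ·ξ` with every multiplicity `mᵢ ≥ 2` (tangency / Riemann singularity) and every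
`kᵢ ≥ 1` (`[D_{2,i}] = kᵢξ`, `NS = ℤξ`): a single component with `m = 2`, `k = 1`, i.e. `m^*Θ̃ = 2D₂`, `[D₂] = ξ`. Recorded: (one component) `m·k ≤ 2`, `m ≥ 2`, `k ≥ 1` force
`(m, k) = (2, 1)`; (two components) impossible. [report 2.2 (c)] -/
theorem picard_one_multiplicity (m k m' k' : ℕ) (hm : 2 ≤ m) (hk : 1 ≤ k) (hm' : 2 ≤ m') (hk' : 1 ≤ k') :
    (m * k ≤ 2 → m = 2 ∧ k = 1) ∧ ¬ (m * k + m' * k' ≤ 2) := by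
  constructor
  · intro h
    have h1 : m * k ≥ 2 * 1 := Nat.mul_le_mul hm hk
    have h2 : m * 1 ≤ m * k := Nat.mul_le_mul_left m hk
    have h3 : 2 * k ≤ m * k := Nat.mul_le_mul_right k hm
    constructor <;> omega
  · intro h
    have h1 : m * k ≥ 2 * 1 := Nat.mul_le_mul hm hk
    have h2 : m' * k' ≥ 2 * 1 := Nat.mul_le_mul hm' hk'
    omega

/-- LEMMA 2.2, the check at `g = 1`: `C` elliptic, `C̃` of genus `2`, `P` an elliptic curve with `θ′ = Θ̃·P = 2` (complementary elliptic curves meeting in `(ℤ/2)²`, `n² = 4`),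
`D₂ = {ω_{C̃}}` ONE point (`ξ = 1`): `θ′ = 2·#D₂` — the doubling holds. Recorded: the arithmetic `n² = 4 ⇒ n = 2`, `2 = 2·1`. [report 2.2, CHECK] -/
theorem baby_case_doubling (n : ℕ) (hn : n * n = 4) : n = 2 ∧ (2 : ℕ) = 2 * 1 := by
  have : n ≤ 2 := by nlinarith
  interval_cases n <;> omega

/-- PROPOSITION 2.4: `rank(res_Z) = 5` for an étale Abel–Prym curve: the image is `f^*H⁰(C, ω_C)` (`g_C = 5`), so `dim Γ_Z = 16 − 5 = 11`, `h⁺(Z) = 5`, `h⁻(Z) = 9 − 5 = 4`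
(`h⁰(Z, 2Θ|_Z) = h⁰(ω_{C̃}) = 9`); the lifts of a reduced canonical divisor: `2⁸ = 256`, half of them (`128 = 2⁷`) in `P⁻`; `dim u⁻¹(V²) ≤ 1 + 2 = 3 < 4 = dim S⁻ = dim |ω_C|`.
Recorded: the arithmetic. [report 2.4] -/
theorem restriction_rank_five :
    (16 : ℤ) - 5 = 11 ∧ (9 : ℤ) - 5 = 4 ∧ (2 : ℕ) ^ 8 = 256 ∧ 256 / 2 = 2 ^ 7 ∧ (1 : ℤ) + 2 < 4 ∧ (5 : ℤ) - 1 = 4 := by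
  norm_num

/-- COROLLARY 2.5, the family dimensions on a general ppav fourfold: étale presentations `2`-dimensional (`dim ℛ₅ − dim 𝒜₄ = 12 − 10`), ramified `1`-dimensional
(`dim ℛ_{4,2} − dim 𝒜₄ = 11 − 10`), `A[2]` finite, theta-duals `1`-dimensional: `dim N_AP^{ét} ≤ 2 + 1 = 3` (a divisor at most), `dim M_AP^{ét} ≤ 2 + 1 + 1 = 4`,
`dim N_AP^{ram} ≤ 1 + 1 = 2`, `dim M_AP^{ram} ≤ 1 + 1 + 1 = 3`; `dim ℛ_{g} = 3g − 3`, `dim ℛ_{g,2} = 3g − 3 + 2`, `dim 𝒜₄ = 10`. Recorded: the arithmetic. [report 2.5] -/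
theorem theta_dual_family_dims :
    (3 * 5 - 3 : ℤ) - 10 = 2 ∧ (3 * 4 - 3 + 2 : ℤ) - 10 = 1 ∧ (2 : ℤ) + 1 = 3 ∧ (2 : ℤ) + 1 + 1 = 4 ∧ (1 : ℤ) + 1 = 2 ∧ (1 : ℤ) + 1 + 1 = 3 ∧
    (4 * 5 / 2 : ℤ) = 10 := by
  norm_num

/-- 2.6, the Mayer–Vietoris bound: `dim(Λ_a ∩ Λ_{a′}) = h⁰(𝓘_{S_a ∪ S_{a′}}(2Θ)) ≥ dim Λ_a + dim Λ_{a′} − h⁰(𝓘_W(2Θ)) = 10 − (16 − w) = w − 6`, `w` = number of conditions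
`W = S_a ∩ S_{a′}` imposes on `|2Θ|`; `Z ⊂ W` imposes exactly `5` (PROP 2.4), so '⊇' of N16-M′ needs `≥ 2` further independent conditions from the residual part of `W`.
Recorded: the arithmetic. [report 2.6] -/
theorem mayer_vietoris_bound (w i : ℤ) (hi : i ≥ 5 + 5 - (16 - w)) : (w ≥ 7 → i ≥ 1) ∧ (5 + 5 - (16 - (5 + 2)) = (1 : ℤ)) := by
  constructor
  · intro hw; omega
  · norm_num

/-- 2.1 / 2.3, the expected class (citation-level remark, not used): [DCP95] `[V^r] = 2^{r(r+1)/2}·∏_{i=1}^{r} i!/(2i)!·ξ^{r(r+1)/2}`; for `r = 2`: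
`2³·(1/2)·(2/24) = 1/3`, and `ξ³/3 = 2·(ξ³/6) = 2γ` — the theta-dual of an Abel–Prym curve has the class of an Abel–Prym curve. Recorded: the rational arithmetic.
[report 2.1] -/
theorem dcp_class_coefficient : (2 : ℚ) ^ 3 * (1 / 2) * (2 / 24) = 1 / 3 ∧ (1 / 3 : ℚ) / (1 / 6) = 2 := by
  norm_num

end H2AbelPrymEigenbundlesThetaDuals

section H2AbelPrymEigenbundlesAddendumA

/-!
## ADDENDUM A (report §6): THEOREM 3 — `h⁺ = 5` on the nodal Abel–Prym curves by degeneration; COROLLARY 3.2 — no pencil nests with Abel–Prym carriers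

Report `H2-EXISTENCE-SIDE-17.md` §6. THEOREM 3 (given the named inputs (F1)–(F3) = Beauville's relative Prym over the admissible-cover degeneration
`C̃/(x̃∼ỹ) → C/(x∼y)` of a ramified presentation): the ι-invariant Abel–Prym curves `Z_t` of the étale general fibres (where `h⁺(Z_t) = 5`, PROPOSITION 2.4) have the
nodal curve `Z_c` as their FLAT limit (degree `16` and `χ = −8` on both sides force `𝒵*₀ = Z_c`), `h⁺` is upper semicontinuous, and THEOREM 1 caps it at `5`: `h⁺(Z_c) = 5`;
hence (1.6 (c)) `M₊ ≅ ω_C(x+y)`, `M₋ ≅ ω_C ⊗ η`, `ν^*𝒪(2Θ) ≅ ω_{C̃}(x̃+ỹ)`, `𝒪_{Z_c}(2Θ) ≅ ω_{Z_c}`. COROLLARY 3.2: with `h⁺ ≡ 5` on all Abel–Prym carriers of a general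
fourfold, `d′ ∈ {1, 2}` everywhere and [XVI] 3.2's bound is never `≤ 1`: no pencil nests with Abel–Prym carriers. Arithmetic only.
-/

/-- THEOREM 3 (ii): the flat limit `𝒵*₀` of the étale Abel–Prym curves `Z_t` (smooth of genus `9`, `𝓛`-degree `16`) contains the nodal curve `Z_c` (`p_a = 9`, `𝓛`-degree `16`
by THEOREM 1 (D) in the ramified case); degree and Euler characteristic are constant in flat families, so the residual 1-cycle has degree `16 − 16 = 0` (no further component)
and the embedded part has length `χ(𝒪_{𝒵*₀}) − χ(𝒪_{Z_c}) = (1 − 9) − (1 − 9) = 0`: `𝒵*₀ = Z_c`. Recorded: the arithmetic. [report 6.1 (ii)] -/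
theorem degeneration_hilbert_polynomial (degt deg0 m extra K : ℤ) (ht : degt = 16) (h0 : deg0 = 16)
    (hcycle : degt = m * deg0 + extra) (hm : 1 ≤ m) (hextra : 0 ≤ extra)
    (hchi : (1 - 9 : ℤ) = (1 - 9) + K) : m = 1 ∧ extra = 0 ∧ K = 0 := by
  subst ht; subst h0
  refine ⟨?_, ?_, by omega⟩ <;> nlinarith

/-- THEOREM 3 (F3): at the central fibre the norm multiplies the gluing parameter `λ` of a line bundle on the one-nodal curve `C̃₀` by itself (`Nm L̃` has fibre `L̃(x̃)^{⊗2}` at the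
node of `C₀`, glued by `λ ⊗ λ`), so `ker Nm₀ ∩ 𝔾_m = {λ : λ² = 1} = {±1}`: the kernel of the norm has exactly two components in the special fibre too (`P₀ ∋ 0` and `P₀′`), as in
the étale fibres (`P ⊔ P′`). Recorded: `λ² = 1 ⇒ λ = ±1` in an integral domain. [report 6.1 (F3)] -/
theorem norm_kernel_components {R : Type} [CommRing R] [IsDomain R] (l : R) (h : l ^ 2 = 1) : l = 1 ∨ l = -1 := by
  have h' : (l - 1) * (l + 1) = 0 := by ring_nf; rw [h]; ring
  rcases mul_eq_zero.mp h' with h1 | h1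
  · left; exact sub_eq_zero.mp h1
  · right; exact eq_neg_of_add_eq_zero_left h1

/-- THEOREM 3 (iii)–(iv): upper semicontinuity gives `h⁺(Z_c) ≥ h⁺(Z_t) = 5` and THEOREM 1 gives `h⁺(Z_c) ≤ 5`, so `h⁺(Z_c) = 5`, `h⁰(Z_c, 𝒪(2Θ)) = 5 + 4 = 9`, and by 1.6 (b)
(`h⁺ = 4 + h¹(M₀)`) `h¹(M₀) = 1`, i.e. `M₀ ≅ ω_{C₀}`. Recorded: the arithmetic. [report 6.1 (iii)–(iv)] -/
theorem hplus_equals_five (hp h1 : ℤ) (hle : hp ≤ 5) (hge : 5 ≤ hp) (hdesc : hp = 4 + h1) :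
    hp = 5 ∧ hp + 4 = 9 ∧ h1 = 1 := by
  omega

/-- THEOREM 3 (iv), the degrees of the identified bundles (`C` of genus `4`, two branch points, `deg η = 1`): `deg ω_C(x+y) = 6 + 2 = 8 = deg M₊`, `deg(ω_C ⊗ η) = 6 + 1 = 7 =
deg M₋`, `deg ω_{C̃}(x̃+ỹ) = 14 + 2 = 16 = deg ν^*𝒪(2Θ)`, and `f^*ω_C(x+y)` has degree `2·8 = 16`; on the nodal `C₀ = C/(x∼y)`: `deg ω_{C₀} = 2·5 − 2 = 8`. Recorded: the
arithmetic. [report 6.1 (iv)] -/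
theorem referee_isomorphism_degrees :
    (2 * 4 - 2 + 2 : ℤ) = 8 ∧ (2 * 4 - 2 + 1 : ℤ) = 7 ∧ (2 * 8 - 2 + 2 : ℤ) = 16 ∧ (2 * 8 : ℤ) = 16 ∧ (2 * 5 - 2 : ℤ) = 8 := by
  norm_num

/-- COROLLARY 3.2: with `h⁺ = 5` at every ι-invariant Abel–Prym curve of a general fourfold, `d′ = 1` (nodal) or `d′ = 2` (étale) at every member, and [XVI] 3.2's bound
`max(0, 4 + d′ − (5 − ρ)(5 − ρ)) + (4 − ρ)` is `≥ 2` for every `0 ≤ ρ ≤ 4` (values `4, 3, 2, 2, 4` for `d′ = 1` and `4, 3, 2, 3, 5` for `d′ = 2`): no pencil nest has an Abel–Prym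
carrier. Recorded: the ten values. [report 6.2] -/
theorem no_pencil_nest_for_AP_carriers (ρ : ℤ) (hρ0 : 0 ≤ ρ) (hρ4 : ρ ≤ 4) :
    2 ≤ max (4 + 1 - (5 - ρ) * (5 - ρ)) 0 + (4 - ρ) ∧ 2 ≤ max (4 + 2 - (5 - ρ) * (5 - ρ)) 0 + (4 - ρ) := by
  constructor
  · exact incidence_no_nest_of_dprime_pos 5 1 ρ (le_refl 5) (le_refl 1) hρ0 hρ4
  · exact incidence_no_nest_of_dprime_pos 5 2 ρ (le_refl 5) (by norm_num) hρ0 hρ4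

end H2AbelPrymEigenbundlesAddendumA

section H2AbelPrymEigenbundlesAddendumC

/-!
## ADDENDUM C (report §8): the nodal carriers never lie over `𝒞°` — the member passes through the 2-torsion point `c` = node of `Z_c`; the repaired open set
## `𝒞°_β` and the local index at `c` — integer shadows

Report `H2-EXISTENCE-SIDE-17.md` §8 (erratum E-P3g24-4 to [XVI] 3.3 (c)(β)'s scope and to [XVII] 1.7 / 6.2 / 6.3 (e)). Every member `D ⊃ Z_c` contains `c ∈ A[2]` and,
all sections of `2Θ` being even, is singular there; on the repaired open set `𝒞°_β` (the 24 nodes on `S_a`, one more ordinary double point at `c`, `Z_c ∩ Sing D = {c}`)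
the hull `𝓛` is invertible at `c`, `T = 𝓛|_{Z_c}`, `(S·Z_c)_D = 4`, and the LOCAL INDEX at `c` vanishes: in ι-linear coordinates `Z_c = {z₃ = z₄ = z₁z₂ = 0}` (generator
weights `−, −, +`), the ι-supertrace of the Koszul complex of `𝒪_{Z_c}` is `1 − (−1) + (−1) − (+1) = 0`, that of `𝒪_D` (even equation) is `1 − 1 = 0`, so `t_c(𝓛 ⊗ 𝓘_{Z_c}) = 0`;
a length-one skyscraper at a 2-torsion point has supertrace `±(1 + 4 + 6 + 4 + 1) = ±16 ≠ 0`. Arithmetic only.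
-/

/-- ADDENDUM C (ii): the ι-supertrace of the Koszul resolution of the nodal curve germ `Z_c = {z₃ = z₄ = z₁z₂ = 0} ⊂ (A, c)` (ι = −1; generator weights `(−1, −1, +1)`):
`Tor₀ : 1`, `Tor₁ : (−1) + (−1) + 1 = −1`, `Tor₂ : (−1)(−1) + (−1)(1) + (−1)(1) = −1`, `Tor₃ : (−1)(−1)(1) = 1`; supertrace `1 − (−1) + (−1) − 1 = 0`. With `t_c(𝒪_D) = 1 − 1 = 0`
(even local equation) and additivity, `t_c(𝓛 ⊗ 𝓘_{Z_c/D}) = ε·(0 − 0) = 0`: the nodal carrier through its own 2-torsion point is t-NEUTRAL. Recorded: the arithmetic.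
[report 8.2] -/
theorem supertrace_nodal_carrier :
    ((-1 : ℤ) + (-1) + 1 = -1) ∧ ((-1 : ℤ) * (-1) + (-1) * 1 + (-1) * 1 = -1) ∧ ((-1 : ℤ) * (-1) * 1 = 1) ∧
    ((1 : ℤ) - (-1) + (-1) - 1 = 0) ∧ ((1 : ℤ) - 1 = 0) ∧ (∀ ε : ℤ, ε * (0 - 0) = 0) := by
  refine ⟨by norm_num, by norm_num, by norm_num, by norm_num, by norm_num, fun ε => by ring⟩

/-- ADDENDUM C (iii): a length-one ι-equivariant skyscraper `k_x` at a fixed point `x` of `ι = −1` on a fourfold has `Tor_i(k_x, k) = Λ^i T_x^* ⊗ k_x` of dimensions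
`1, 4, 6, 4, 1` with ι acting by `ε(−1)^i`; its supertrace is `ε(1 + 4 + 6 + 4 + 1) = 16ε ≠ 0` — so 0-dimensional junk of length ONE at a 2-torsion point breaks `t ≡ 0`;
t-neutral junk there has even length with balanced signs. For comparison an ODD hypersurface equation gives `t_x(𝒪_D) = 1 − (−1) = 2` (the `‖t‖² = 8·4 = 32` of smooth
symmetric members through 8 half-periods). Recorded: the arithmetic. [report 8.3] -/
theorem supertrace_skyscraper (ε : ℤ) (hε : ε = 1 ∨ ε = -1) :
    ε * (1 + 4 + 6 + 4 + 1) = 16 * ε ∧ ε * 16 ≠ 0 ∧ ((1 : ℤ) - (-1) = 2) ∧ (8 * 2 ^ 2 = (32 : ℤ)) := by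
  refine ⟨by ring, ?_, by norm_num, by norm_num⟩
  rcases hε with h | h <;> subst h <;> norm_num

/-- ADDENDUM C (iv): on the repaired open set `𝒞°_β` the member `D` carries `24 + 1 = 25` ordinary double points (the 24 on `S_a` and the one at `c`), the incidence
bound of [XVI] 3.2 is UNCHANGED (the condition `c ∈ D` is automatic for `D ⊃ Z_c`, no dimension drop: values `4, 3, 2, 2, 4` at `h⁺ = 5`, `d′ = 1`), whereas for a
2-torsion point `x ≠ c` the bound drops by one (6.3 (e)). Recorded: `24 + 1 = 25` and the two rows. [report 8.4] -/
theorem repaired_open_set_rows (ρ : ℤ) (hρ0 : 0 ≤ ρ) (hρ4 : ρ ≤ 4) :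
    (24 + 1 = (25 : ℤ)) ∧ 2 ≤ max (4 + 1 - (5 - ρ) * (5 - ρ)) 0 + (4 - ρ) ∧ 1 ≤ max (4 + 1 - (5 - ρ) * (5 - ρ)) 0 + (3 - ρ) := by
  refine ⟨by norm_num, (no_pencil_nest_for_AP_carriers ρ hρ0 hρ4).1, ?_⟩
  have h := (no_pencil_nest_for_AP_carriers ρ hρ0 hρ4).1
  omega

end H2AbelPrymEigenbundlesAddendumC

end Summit.HodgeConjecture.HodgeConjecture.WeilTypeLadder
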